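import Summits.HodgeConjecture.HodgeConjecture.Theorems.F0P3cStCharTSUpTrJacSplitDockTwo     -- ★ p852456 ∕ ED. 2 p852496 (this seat) (B8-D): `tubeJacobianLocal_splitCartan_U2_of_model₂` (CM dock₂ modulo the model socket, `D₂` letter); brings ★ Q9, the model pins, `placeForm_antidiagTwo_eq`
import Summits.HodgeConjecture.HodgeConjecture.Theorems.F0P3cStCharTSUpTrU2JacModel          -- ★ p852439 ∕ ED. 2 p852483 (LH1-p03 g10) (B7): `tubeJacobianLocal_torusU_of_orbitTube`, `isCompact_isOpen_level`, `antitone_level`, `level_basis_of_schedule`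
import Summits.HodgeConjecture.HodgeConjecture.Theorems.F0P3cStCharTSUpTrU2Horbit            -- (B7b) (LH4-p01 g8): `horbit_torusU_two` (ORBIT-TUBE₂ + MASS on the level cosets, weight `D₂`)
import Summits.HodgeConjecture.HodgeConjecture.Theorems.F0P3cStCharTSUpTrU2SandwichMeasure   -- (B5-M) B₂ (LH7-p03 g6): `measure_boxProduct_eq_weight_mul_measure_level` (the `hPM` sandwich measure)
import Summits.HodgeConjecture.HodgeConjecture.Theorems.F0P3cStCharTSUpTrU2Norm              -- ★ p852421 (LH4-p02 g10) (B4) NORM₂: `index_torusU_subgroupOf_normalizer_two_ne_zero`, `exists_mem_torusU_isRegularElt_two`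
import Literature.NumberTheory.Rogawski1990.ExplicitFactorKappaAlmostEverywhereOne           -- ★ `galAdicCompletionMap_complexConj_algebraMap` (a skew element of `L_w` from the CM generator)
import Literature.NumberTheory.Automorphic.QuadraticHeckeCharacterCM                         -- ★ `cmQuadraticGenerator_spec` (`∃ α ≠ 0, cα = −α`)
import HarnessLib

/-!
# F0 · P3c · line LH6 «StCharTS» — ROAD «UP-TR», JAC-LOC₂ brick (B8-D) «SPLIT DOCK₂», file A «MODEL TERMINUS + CM DOCK₂ (unconditional)»: the local tube-Jacobian socket at
# the split torus `T(K)` of `U(σ, Φ₂)(K)` with weight `D₂ t = √(‖a − 1‖_K·‖a⁻¹ − 1‖_K)`, and the (B8) `hDock` binder on `U(Φ₂)(L⁺_v)` at `M₂ = (cmBorelTriple L 2 v).M`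

Cell `pub/hodgecm-mathlib`, crux H413 = `stmt-HodgeConjecture-24833` (lane `--supports … --as helper`), route HCCMUnconditional; seat LH6-p04 (g7); ROAD «UP-TR» (holder F0P3-p02 (g23)),
sub-road «JAC-LOC₂» (sub-dealer LH7-p02 (g8)); brick (B8-D) «SPLIT DOCK₂» dealt 2026-09-02T19:02Z, model terminus taken 2026-09-02T19:28Z on (B7b)'s hand-over.  THEOREMS ONLY (no
definition ∕ instance ∕ notation ∕ named fact ∕ `sorry`); ★-only imports.

WHAT.  §1 **`tubeJacobianLocal_splitTorus_model`** — the MODEL TERMINUS of sub-road «JAC-LOC₂», generic over a non-archimedean local field `K` with a continuous isometric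
involution `σ`, a skew unit `θ` (`σθ = −θ`) and `2 ∈ Kˣ`, `J = Φ₂`, `U′ = U(σ, J)(K)` (locally compact, second countable, Hausdorff), `T = torusU σ J`, any conjugation family
`Φ(xT, t) = x t x⁻¹` and ALL Haar data `(ν, tm)`: for a regular `t₀ ∈ T` there are an open `U ∋ t₀` and a base set `A₀` of positive finite `ν∕tm`-measure such that for every
measurable `W`-free `V ⊆ U` of regular elements `ν(Φ(A₀ × V)) = (ν∕tm)(A₀) · ∫_V D₂ dtm`, **`D₂ t = √(‖a − 1‖_K · ‖a⁻¹ − 1‖_K)`, `a = t₀₀ · σ t₀₀`** — Harish-Chandra's Lemma 22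
∕ van Dijk §2 for `U(1,1)`.  It is ★ (B7) `tubeJacobianLocal_torusU_of_orbitTube` (LH1-p03) fed with: `hW` = ★ (B4) `index_torusU_subgroupOf_normalizer_two_ne_zero` (LH4-p02) at
the regular diagonal element `d(α, α⁻¹)`, `α = x·σx`, `0 < v(x) < 1` (★ (B4) §5); the levels `Kl n = K_{γ₀^{n+1}} ∩ U′` of the schedule `δ n = γ₀^{n+1}`, `0 < γ₀ < 1`
(`ValuativeRel.IsNontrivial.exists_lt_one`), compact open (★ (B7) §3 `isCompact_isOpen_level`), antitone (`antitone_level`), a neighbourhood basis (★ (B7) ED. 2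
`level_basis_of_schedule` over ★ `exists_pow_mul_le`); and `horbit` = (B7b) `horbit_torusU_two` (LH4-p01) with its sandwich-measure input `hPM` = (B5-M)
`measure_boxProduct_eq_weight_mul_measure_level` (LH7-p03, over BOX-HAAR₂ of LH4-p02 and (B2a)(B2b) of LH4-p03 ∕ F0P3a-p01).
§2 **`tubeJacobianLocal_splitCartan_U2 (L v) (hns)`** — the `hDock` binder of ★ (B8) TERMINUS `F0P3cStCharTSUpTrJacCartanSplitH.tubeJacobianLocal_splitCartanH_of_dock` (LH7-p02)
TOKEN FOR TOKEN, unconditional: ★ ED. 2 `tubeJacobianLocal_splitCartan_U2_of_model₂` (CM dock₂ in the `D₂` letter, any place `w ∣ v`) at `K := L_w`, `σ := σ_w = galAdicCompletionMap c`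
(involutive ★ `galAdicCompletionMap_galAdicCompletionMap_of_smul_eq`, isometric ★ `valuation_galAdicCompletionMap_eq`, continuous ★ `continuous_galAdicCompletionMap`),
`J := (Φ₂)_w = Φ₂ over L_w` (★ `placeForm_antidiagTwo_eq`), `θ := (α)_w` for the CM generator `α` (`cα = −α`, ★ `cmQuadraticGenerator_spec`, ★ `galAdicCompletionMap_complexConj_algebraMap`),
`2 ∈ L_wˣ` (characteristic `0`), and §1.  With it LH7-p02's (B8) ED. 2 `tubeJacobianLocal_splitCartanH := …_of_dock L v hns (tubeJacobianLocal_splitCartan_U2 L v hns)` closes (H4s).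
HONEST LABEL: count-neutral plumbing toward `hUpTr` via WIF-H (the (H4s) Jacobian socket becomes unconditional); HC_CM is proved only modulo the 7 printed citations (2 remaining:
hLiu418 = `stmt-HodgeConjecture-24832`, h413 = `stmt-HodgeConjecture-24833`) until rung 0 closes.

## References
* [HarishChandra1970] Harish-Chandra (notes by G. van Dijk), *Harmonic analysis on reductive p-adic groups*, LNM 162 (1970), Part V §4 Lemma 22; Lemma 42.
* [vanDijk1972] G. van Dijk, *Computation of certain induced characters of p-adic groups*, Math. Ann. 199 (1972), §2.
* [Rogawski1990] J. D. Rogawski, *Automorphic Representations of Unitary Groups in Three Variables*, Ann. of Math. Stud. 123 (1990), §12.5 pp. 182–183, §4.9 p. 54, §1.10 p. 9.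
* [Casselman1995] W. Casselman, *Introduction to the theory of admissible representations of p-adic reductive groups* (draft 1995), Prop. 1.4.4.
* [PlatonovRapinchuk1994] V. Platonov, A. Rapinchuk, *Algebraic Groups and Number Theory* (1994), §5.1 (the one-place model).
-/

set_option autoImplicit false
-- the mandated namespace has the single-problem summit's repeated segment (`HodgeConjecture.HodgeConjecture`)
set_option linter.dupNamespace false

noncomputable section

open MeasureTheory Measure Set Filter Topology Function NumberField IsDedekindDomain ValuativeRel
open Literature.MeasureTheory.Group
open Literature.NumberTheory.Automorphic Literature.NumberTheory.Automorphic.UnitaryGroup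
open Literature.NumberTheory.GaloisRepresentations.IsNonarchimedeanLocalField (normAbs)
open Literature.NumberTheory.Rogawski1990 (IsRegularElt)
open scoped ENNReal NNReal Matrix MatrixGroups Pointwise

namespace Summit.HodgeConjecture.HodgeConjecture.Cruxes.H413.F0P3cStCharTSUpTrJacSplitModelTwo

/-! ## §1 The model terminus at the split torus of `U(σ, Φ₂)(K)`, weight `D₂` -/

section Model

variable {K : Type*} [Field K] [ValuativeRel K] [TopologicalSpace K] [IsNonarchimedeanLocalField K] [IsTopologicalRing K]
  (σ : K →+* K) (hσ : ∀ x, σ (σ x) = x) (hσv : ∀ x, valuation K (σ x) = valuation K x) (hσc : Continuous σ)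
  {J : Matrix (Fin 2) (Fin 2) K} (hJ : J = (StdForm.antidiagonal 2).over K)

omit [IsTopologicalRing K] in
include hσ hσv hJ in
/-- **A regular element of the split torus `T(K)` and `[N(T) : T] ≠ 0`** for `U(σ, Φ₂)(K)`: with `0 ≠ x`, `v(x) < 1` (the valuation is non-trivial) the `σ`-fixed unit `α := x·σx` has
`v(α) = v(x)² < 1`, so `α ≠ α⁻¹` and `d(α, α⁻¹) ∈ T` is regular (★ (B4) §5 `exists_mem_torusU_isRegularElt_two`); hence the Weyl index hypothesis `hW` of ★ (B7) (★ (B4)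
`index_torusU_subgroupOf_normalizer_two_ne_zero`, `[N(T) : T] = 2`). [cite: Rogawski1990, §12.5 p. 182; §3.1 p. 19] [cite: HarishChandra1970, Lemma 42] -/
theorem index_torusU_subgroupOf_normalizer_ne_zero_model :
    ((torusU σ J).subgroupOf (Subgroup.normalizer (torusU σ J : Set ↥(unitaryGroupOfForm σ J)))).index ≠ 0 := by
  obtain ⟨x, hx0, hx1⟩ := Valuation.IsNontrivial.exists_lt_one (v := valuation K)
  have hσx0 : σ x ≠ 0 := (map_ne_zero σ).2 hx0
  have hxσ0 : x * σ x ≠ 0 := mul_ne_zero hx0 hσx0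
  set α : Kˣ := Units.mk0 (x * σ x) hxσ0 with hα
  have hασ : σ (α : K) = α := by rw [hα, Units.val_mk0, map_mul, hσ, mul_comm]
  have hvα : valuation K (α : K) < 1 := by
    rw [hα, Units.val_mk0, map_mul, hσv, ← pow_two]
    exact pow_lt_one₀ zero_le hx1 two_ne_zero
  have hu : IsUnit ((α : K) - ((α⁻¹ : Kˣ) : K)) := by
    rw [isUnit_iff_ne_zero, sub_ne_zero]
    intro h
    have h2 : (α : K) * α = 1 := by
      calc (α : K) * α = α * ((α⁻¹ : Kˣ) : K) := by rw [← h]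
        _ = 1 := Units.mul_inv α
    have h3 : valuation K (α : K) ^ 2 = 1 := by rw [pow_two, ← map_mul, h2, map_one]
    exact absurd h3 (pow_lt_one₀ zero_le hvα two_ne_zero).ne
  exact F0P3cStCharTSUpTrU2Norm.index_torusU_subgroupOf_normalizer_two_ne_zero σ (fun y hy => isUnit_iff_ne_zero.2 hy) hJ
    (F0P3cStCharTSUpTrU2Norm.exists_mem_torusU_isRegularElt_two σ hJ α hασ hu)

omit [IsTopologicalRing K] in
/-- **The geometric level schedule `δ n = γ₀^{n+1}`, `0 < γ₀ < 1`**: non-zero, `< 1`, antitone, and eventually below (`≤` and `<`) every `γ ≠ 0` (the value group is archimedean,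
★ `exists_pow_mul_le`) — the `(δ, hδ1, hδ0, hanti, hsmall)` inputs of (B7b) `horbit_torusU_two` and, via ★ (B7) §3, the levels `Kl n = K_{δ n} ∩ U′` of ★ (B7).
[cite: Casselman1995, Prop. 1.4.4] -/
theorem exists_geometric_schedule :
    ∃ δ : ℕ → ValueGroupWithZero K, (∀ n, δ n < 1) ∧ (∀ n, δ n ≠ 0) ∧ Antitone δ ∧
      (∀ γ : ValueGroupWithZero K, γ ≠ 0 → ∃ n, δ n ≤ γ) ∧ (∀ γ : ValueGroupWithZero K, γ ≠ 0 → ∃ n, δ n < γ) := by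
  obtain ⟨γ₀, hγ₀0, hγ₀1⟩ := ValuativeRel.IsNontrivial.exists_lt_one (R := K)
  have hγ₀0' : γ₀ ≠ 0 := ne_of_gt hγ₀0
  have hle : ∀ γ : ValueGroupWithZero K, γ ≠ 0 → ∃ n, γ₀ ^ (n + 1) ≤ γ := fun γ hγ => by
    obtain ⟨d, hd⟩ := exists_pow_mul_le hγ₀0' hγ₀1 γ₀ hγ
    exact ⟨d, by rw [pow_succ]; exact hd⟩
  refine ⟨fun n => γ₀ ^ (n + 1), fun n => pow_lt_one₀ hγ₀0.le hγ₀1 (Nat.succ_ne_zero n), fun n => pow_ne_zero _ hγ₀0',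
    fun m n hmn => pow_le_pow_right_of_le_one' hγ₀1.le (Nat.succ_le_succ hmn), hle, fun γ hγ => ?_⟩
  obtain ⟨n, hn⟩ := hle γ hγ
  exact ⟨n + 1, lt_of_lt_of_le (pow_lt_pow_right_of_lt_one₀ hγ₀0 hγ₀1 (Nat.lt_succ_self (n + 1))) hn⟩

set_option maxHeartbeats 1600000 in
-- the long socket binders of ★ (B7) ∕ (B7b) at the model
include hσ hσv hσc hJ in
/-- **§1 THE MODEL TERMINUS OF SUB-ROAD «JAC-LOC₂» — the local tube-Jacobian socket at the split torus `T(K)` of `U′ = U(σ, Φ₂)(K)` with the weight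
`D₂ t = √(‖a − 1‖_K · ‖a⁻¹ − 1‖_K)`, `a = t₀₀ · σ t₀₀`**, for every conjugation family `Φ(xT, t) = x t x⁻¹` and ALL Haar data `(ν, tm)` (the `hmodel₂` clause of ★ (B8-D) ED. 2
`tubeJacobianLocal_splitCartan_U2_of_model₂`, read at `K = L_w`).  See the module docstring for the assembly: ★ (B7) `tubeJacobianLocal_torusU_of_orbitTube` ← §1 `hW`, the geometric
schedule and its levels (★ (B7) §3), (B7b) `horbit_torusU_two` ← (B5-M) `measure_boxProduct_eq_weight_mul_measure_level`. [cite: HarishChandra1970, Lemma 22] [cite: vanDijk1972, §2]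
[cite: Rogawski1990, §12.5 pp. 182–183] [cite: Casselman1995, Prop. 1.4.4] -/
theorem tubeJacobianLocal_splitTorus_model [Invertible (2 : K)] (θ : Kˣ) (hθ : σ (θ : K) = -θ)
    [MeasurableSpace ↥(unitaryGroupOfForm σ J)] [BorelSpace ↥(unitaryGroupOfForm σ J)] [LocallyCompactSpace ↥(unitaryGroupOfForm σ J)]
    [SecondCountableTopology ↥(unitaryGroupOfForm σ J)] [T2Space ↥(unitaryGroupOfForm σ J)]
    [MeasurableSpace (↥(unitaryGroupOfForm σ J) ⧸ torusU σ J)] [BorelSpace (↥(unitaryGroupOfForm σ J) ⧸ torusU σ J)]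
    (Φ : (↥(unitaryGroupOfForm σ J) ⧸ torusU σ J) × ↥(torusU σ J) → ↥(unitaryGroupOfForm σ J))
    (hΦ : ∀ (x : ↥(unitaryGroupOfForm σ J)) (t : ↥(torusU σ J)), Φ (QuotientGroup.mk x, t) = x * t * x⁻¹)
    (hTc : IsClosed ((torusU σ J : Subgroup ↥(unitaryGroupOfForm σ J)) : Set ↥(unitaryGroupOfForm σ J)))
    (ν : Measure ↥(unitaryGroupOfForm σ J)) [ν.IsHaarMeasure] [ν.IsMulRightInvariant]
    (tm : Measure ↥(torusU σ J)) [tm.IsMulLeftInvariant] [IsFiniteMeasureOnCompacts tm] [tm.IsOpenPosMeasure] [tm.IsInvInvariant] :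
    ∀ t₀ : ↥(torusU σ J), IsRegularElt (((t₀ : ↥(unitaryGroupOfForm σ J))) : GL (Fin 2) K) →
      ∃ U : Set ↥(torusU σ J), IsOpen U ∧ t₀ ∈ U ∧
        ∃ A₀ : Set (↥(unitaryGroupOfForm σ J) ⧸ torusU σ J), MeasurableSet A₀ ∧
          quotientMeasure _ tm hTc ν A₀ ≠ 0 ∧ quotientMeasure _ tm hTc ν A₀ ≠ ∞ ∧
          ∀ V : Set ↥(torusU σ J), MeasurableSet V → V ⊆ U →
            (∀ t ∈ V, IsRegularElt (((t : ↥(unitaryGroupOfForm σ J))) : GL (Fin 2) K)) →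
            (∀ n : ↥(unitaryGroupOfForm σ J), n ∉ torusU σ J →
              ∀ t ∈ V, ∀ t' ∈ V, ((t' : ↥(torusU σ J)) : ↥(unitaryGroupOfForm σ J)) ≠ n * t * n⁻¹) →
              ν (Φ '' (A₀ ×ˢ V)) = quotientMeasure _ tm hTc ν A₀ *
                ∫⁻ t in V, ↑(NNReal.sqrt (normAbs K ((((((t : ↥(unitaryGroupOfForm σ J))) : GL (Fin 2) K) : Matrix (Fin 2) (Fin 2) K) 0 0) * σ (((((t : ↥(unitaryGroupOfForm σ J))) : GL (Fin 2) K) : Matrix (Fin 2) (Fin 2) K) 0 0) - 1) *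
                  normAbs K (((((((t : ↥(unitaryGroupOfForm σ J))) : GL (Fin 2) K) : Matrix (Fin 2) (Fin 2) K) 0 0) * σ (((((t : ↥(unitaryGroupOfForm σ J))) : GL (Fin 2) K) : Matrix (Fin 2) (Fin 2) K) 0 0))⁻¹ - 1))) ∂tm := by
  haveI : T2Space K := (Literature.NumberTheory.GaloisRepresentations.IsNonarchimedeanLocalField.isLocalField K).toT2Space
  -- the Weyl index, the schedule and its levels
  have hW := index_torusU_subgroupOf_normalizer_ne_zero_model σ hσ hσv hJ
  obtain ⟨δ, hδ1, hδ0, hanti, hsmall_le, hsmall⟩ := exists_geometric_schedule (K := K)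
  have hKoc := fun n => F0P3cStCharTSUpTrU2JacModel.isCompact_isOpen_level σ J hσc (hδ0 n)
  -- ★ (B7) fed with (B7b) ← (B5-M)
  exact F0P3cStCharTSUpTrU2JacModel.tubeJacobianLocal_torusU_of_orbitTube σ J ν tm Φ hΦ hW
    (fun t => NNReal.sqrt (normAbs K ((((((t : ↥(unitaryGroupOfForm σ J))) : GL (Fin 2) K) : Matrix (Fin 2) (Fin 2) K) 0 0) * σ (((((t : ↥(unitaryGroupOfForm σ J))) : GL (Fin 2) K) : Matrix (Fin 2) (Fin 2) K) 0 0) - 1) *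
      normAbs K (((((((t : ↥(unitaryGroupOfForm σ J))) : GL (Fin 2) K) : Matrix (Fin 2) (Fin 2) K) 0 0) * σ (((((t : ↥(unitaryGroupOfForm σ J))) : GL (Fin 2) K) : Matrix (Fin 2) (Fin 2) K) 0 0))⁻¹ - 1)))
    (fun n => (congruenceGL 2 (δ n)).comap (unitaryGroupOfForm σ J).subtype) (fun n => (hKoc n).2) (fun n => (hKoc n).1)
    (F0P3cStCharTSUpTrU2JacModel.antitone_level σ J hanti) (F0P3cStCharTSUpTrU2JacModel.level_basis_of_schedule σ J hsmall_le)
    (F0P3cStCharTSUpTrU2Horbit.horbit_torusU_two σ hσ hσv hσc hJ ν δ hδ1 hδ0 hanti hsmall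
      (fun {γ} hγ hγ0 {s} hs ha1 hprod =>
        F0P3cStCharTSUpTrU2SandwichMeasure.measure_boxProduct_eq_weight_mul_measure_level σ hJ hσ hσc hσv θ hθ ν hγ hγ0 hs ha1 hprod))

end Model

/-! ## §2 The CM dock₂, unconditional: the `hDock` binder of ★ (B8) `tubeJacobianLocal_splitCartanH_of_dock` -/

section CM

variable (L : Type) [Field L] [NumberField L] [IsCMField L] (v : HeightOneSpectrum (𝓞 ↥(maximalRealSubfield L)))
  (hns : ∀ w : PlacesOver L v, IsCMField.complexConj L • w.1 = w.1)

set_option maxHeartbeats 1600000 in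
-- the long socket binders at `N = 2`
include hns in
/-- **(B8-D) «SPLIT DOCK₂» — THE `hDock` BINDER OF ★ (B8) `F0P3cStCharTSUpTrJacCartanSplitH.tubeJacobianLocal_splitCartanH_of_dock`, UNCONDITIONAL.**  On `G₂ = U(Φ₂)(L⁺_v) =
(cmDatum L 2 Φ₂).Local v` at a place `v` non-split in the CM field `L`, at the split torus `T = M₂ = (cmBorelTriple L 2 v).M`, for the given Haar data `(ν, tm)`, every conjugation
family `Φ` and RUNG0's `eDH` radicand weight `√(∏_{w′}|disc χ_t|_{w′}·(∏_{w′}|det t|_{w′})⁻¹)`: the local tube-Jacobian socket — ★ ED. 2 `tubeJacobianLocal_splitCartan_U2_of_model₂` (any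
`w ∣ v`) + §1 at `K = L_w`, `σ = σ_w`, `J = (Φ₂)_w`, `θ = (α)_w` (`cα = −α`), `2 ∈ L_wˣ`.  Consumed by LH7-p02's (B8) ED. 2 as `hDock := tubeJacobianLocal_splitCartan_U2 L v hns`.
[cite: HarishChandra1970, Lemma 22] [cite: vanDijk1972, §2] [cite: Rogawski1990, §12.5 pp. 182–183; §4.9 p. 54] [cite: PlatonovRapinchuk1994, §5.1] -/
theorem tubeJacobianLocal_splitCartan_U2
    [instM : MeasurableSpace ((UnitaryGroup.cmDatum L 2 (Matrix.of fun i j : Fin 2 => if i.val + j.val + 1 = 2 then (1 : L) else 0)).Local v)] [instB : BorelSpace ((UnitaryGroup.cmDatum L 2 (Matrix.of fun i j : Fin 2 => if i.val + j.val + 1 = 2 then (1 : L) else 0)).Local v)]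
    {T : Subgroup ((UnitaryGroup.cmDatum L 2 (Matrix.of fun i j : Fin 2 => if i.val + j.val + 1 = 2 then (1 : L) else 0)).Local v)} (hT₂ : T = (cmBorelTriple L 2 v).M)
    (Φ : ((UnitaryGroup.cmDatum L 2 (Matrix.of fun i j : Fin 2 => if i.val + j.val + 1 = 2 then (1 : L) else 0)).Local v ⧸ T) × ↥T → (UnitaryGroup.cmDatum L 2 (Matrix.of fun i j : Fin 2 => if i.val + j.val + 1 = 2 then (1 : L) else 0)).Local v) (hΦ : ∀ (x : (UnitaryGroup.cmDatum L 2 (Matrix.of fun i j : Fin 2 => if i.val + j.val + 1 = 2 then (1 : L) else 0)).Local v) (t : ↥T), Φ (QuotientGroup.mk x, t) = x * t * x⁻¹)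
    (hTc : IsClosed (T : Set ((UnitaryGroup.cmDatum L 2 (Matrix.of fun i j : Fin 2 => if i.val + j.val + 1 = 2 then (1 : L) else 0)).Local v)))
    [instQM : MeasurableSpace ((UnitaryGroup.cmDatum L 2 (Matrix.of fun i j : Fin 2 => if i.val + j.val + 1 = 2 then (1 : L) else 0)).Local v ⧸ T)] [instQB : BorelSpace ((UnitaryGroup.cmDatum L 2 (Matrix.of fun i j : Fin 2 => if i.val + j.val + 1 = 2 then (1 : L) else 0)).Local v ⧸ T)]
    (ν : Measure ((UnitaryGroup.cmDatum L 2 (Matrix.of fun i j : Fin 2 => if i.val + j.val + 1 = 2 then (1 : L) else 0)).Local v)) [instν₁ : ν.IsHaarMeasure] [instν₂ : ν.IsMulRightInvariant]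
    (tm : Measure ↥T) [instt₁ : tm.IsMulLeftInvariant] [instt₂ : IsFiniteMeasureOnCompacts tm] [instt₃ : tm.IsOpenPosMeasure] [instt₄ : tm.IsInvInvariant] :
    ∀ t₀ : ↥T, IsRegularElt (((t₀ : (UnitaryGroup.cmDatum L 2 (Matrix.of fun i j : Fin 2 => if i.val + j.val + 1 = 2 then (1 : L) else 0)).Local v)).val : GL (Fin 2) (UnitaryGroup.LocalRing L v)) →
      ∃ U : Set ↥T, IsOpen U ∧ t₀ ∈ U ∧
        ∃ A₀ : Set ((UnitaryGroup.cmDatum L 2 (Matrix.of fun i j : Fin 2 => if i.val + j.val + 1 = 2 then (1 : L) else 0)).Local v ⧸ T), MeasurableSet A₀ ∧ (quotientMeasure T tm hTc ν) A₀ ≠ 0 ∧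
          (quotientMeasure T tm hTc ν) A₀ ≠ ∞ ∧
          ∀ V : Set ↥T, MeasurableSet V → V ⊆ U → (∀ t ∈ V, IsRegularElt (((t : (UnitaryGroup.cmDatum L 2 (Matrix.of fun i j : Fin 2 => if i.val + j.val + 1 = 2 then (1 : L) else 0)).Local v)).val : GL (Fin 2) (UnitaryGroup.LocalRing L v))) →
            (∀ n : (UnitaryGroup.cmDatum L 2 (Matrix.of fun i j : Fin 2 => if i.val + j.val + 1 = 2 then (1 : L) else 0)).Local v, n ∉ T → ∀ t ∈ V, ∀ t' ∈ V, ((t' : ↥T) : (UnitaryGroup.cmDatum L 2 (Matrix.of fun i j : Fin 2 => if i.val + j.val + 1 = 2 then (1 : L) else 0)).Local v) ≠ n * t * n⁻¹) →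
              ν (Φ '' (A₀ ×ˢ V)) = (quotientMeasure T tm hTc ν) A₀ *
                ∫⁻ t in V, ↑(NNReal.sqrt ((∏ w' : PlacesOver L v, normAbs (w'.1.adicCompletion L) ((((t : (UnitaryGroup.cmDatum L 2 (Matrix.of fun i j : Fin 2 => if i.val + j.val + 1 = 2 then (1 : L) else 0)).Local v).val : GL (Fin 2) (UnitaryGroup.LocalRing L v)).val.charpoly.discr) w')) * (∏ w' : PlacesOver L v, normAbs (w'.1.adicCompletion L) ((((t : (UnitaryGroup.cmDatum L 2 (Matrix.of fun i j : Fin 2 => if i.val + j.val + 1 = 2 then (1 : L) else 0)).Local v).val : GL (Fin 2) (UnitaryGroup.LocalRing L v)).val.det) w'))⁻¹)) ∂tm := by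
  classical
  obtain ⟨w⟩ := (inferInstance : Nonempty (PlacesOver L v))
  have hw : IsCMField.complexConj L • w.1 = w.1 := hns w
  haveI : Algebra.IsQuadraticExtension ↥(maximalRealSubfield L) L := IsCMField.isQuadraticExtension L
  -- a skew element of `L_w`: the CM generator read at `w`
  obtain ⟨α, hα0, hcα, -⟩ := cmQuadraticGenerator_spec L
  have hθ0 : algebraMap L (w.1.adicCompletion L) α ≠ 0 := fun h0 =>
    hα0 ((algebraMap L (w.1.adicCompletion L)).injective (by rw [h0, map_zero]))
  have hθ : galAdicCompletionMap (L := L) (IsCMField.complexConj L) hw ((Units.mk0 (algebraMap L (w.1.adicCompletion L) α) hθ0 : (w.1.adicCompletion L)ˣ) : w.1.adicCompletion L) =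
      -((Units.mk0 (algebraMap L (w.1.adicCompletion L) α) hθ0 : (w.1.adicCompletion L)ˣ) : w.1.adicCompletion L) := by
    rw [Units.val_mk0, Literature.NumberTheory.Rogawski1990.galAdicCompletionMap_complexConj_algebraMap L v w hw α, cmConjRingHom_apply, hcα, map_neg]
  letI : Invertible (2 : w.1.adicCompletion L) := invertibleOfNonzero two_ne_zero
  refine F0P3cStCharTSUpTrJacSplitDockTwo.tubeJacobianLocal_splitCartan_U2_of_model₂ L v hns w hw hT₂ Φ hΦ hTc ν tm ?_
  intro _i₁ _i₂ _i₃ _i₄ _i₅ _i₆ _i₇ Φ' hΦ' hT'c ν' _i₈ _i₉ tm' _i₁₀ _i₁₁ _i₁₂ _i₁₃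
  exact tubeJacobianLocal_splitTorus_model (galAdicCompletionMap (L := L) (IsCMField.complexConj L) hw)
    (galAdicCompletionMap_galAdicCompletionMap_of_smul_eq (IsCMField.complexConj L) w (IsCMField.complexConj_ne_one L) hw)
    (fun x => valuation_galAdicCompletionMap_eq (IsCMField.complexConj L) v w hw x)
    (continuous_galAdicCompletionMap L (IsCMField.complexConj L) hw)
    (F0P3cCMLocalNonsplitBorelTransportU2.placeForm_antidiagTwo_eq L v w) (Units.mk0 (algebraMap L (w.1.adicCompletion L) α) hθ0) hθ
    Φ' hΦ' hT'c ν' tm'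

end CM

end Summit.HodgeConjecture.HodgeConjecture.Cruxes.H413.F0P3cStCharTSUpTrJacSplitModelTwo

end
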